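/-
Copyright (c) 2026. All rights reserved.
Released under Apache 2.0 license as described in the file LICENSE.
Authors: abc-iut cell, wave-4 seat abc-iut-w4-d059 (the chart representatives READ OFF a subgroup presentation,
as a definition — the pin `hRcV`/`hRcB` of the Thm 5.4 theorem of record made a term).
-/
import Literature.AnabelianGeometry.SemiGraphs.ArithVertGpNormalizerDictionary
import HarnessLib

/-!
# [SemiAnbd] §5 p. 65: the compatible §3 representatives read off a subgroup presentation (definition)

Mochizuki, *Semi-graphs of anabelioids*, Publ. RIMS **42** (2006), §5 p. 65 ("`Π^temp_{𝔊,v}`, `Π^temp_{𝔊,b}`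
… well-defined up to conjugation"; the decomposition groups are those of the chosen vertex / branch lifts)
and the proof of Thm 3.7 (iii) p. 41 with the author's Comments (6) (the presentation of `π₁^temp` by
verticial subgroups `H_w`, edge subgroups `M_e` and branch elements `s_b` with `s_b M_e s_b⁻¹ ⊆ H_w`).
[cite: MochizukiSemiAnbd2006, §5, p. 65]

DEFINITION file (abc-iut cell, layer L3, sub-DAG `plan/L3/SUBDAG-SemiAnbd-Thm54.md`, T54 board; seat
abc-iut-w4-d059 gen 4).  abc-iut-w4-d053's producer `decompositionDataOfChart R ι` takes ANY compatible choice
`R : ChartRepresentatives c`; the (AI4″) producer of the Thm 5.4 theorem of record and the design hypothesis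
`hest` (total arithmetic estrangement, Def 5.3 (ii)) are read at the representatives MATCHED to abc-iut-L3-d4's
presentation `P` — so far as a binder `Rc` with two equations `hRcV : Rc.Hv = P.H`,
`hRcB : Rc.Hb b = s_b M_{e(b)} s_b⁻¹` (this seat's `exists_chartRepresentatives_of_presentation` proves they are
satisfiable).  Here that choice is a TERM:

* `ChartRepresentatives.ofPresentation c P hPH hPM` — `Hv := P.H`, `Hb b := s_b · M_{e(b)} · s_b⁻¹`; verticial by
  `hPH`, edge-like as a conjugate of the edge-like `M_e` (`hPM`), `Hb b ≤ Hv v` by the presentation axiom;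
* `ofPresentation_Hv`, `ofPresentation_Hb` (`rfl`) — the equations `hRcV`/`hRcB` as `simp` lemmas, so every
  theorem stated with the binders `(Rc) (hRcV) (hRcB)` instantiates at `ofPresentation … , fun _ => rfl, fun _ => rfl`.

With this seat's Rc-invariance (`arithMaximalCompactStatementI/II_iff_chart`, ArithMaximalCompactRcInvariance.lean)
a consumer may state Thm 5.4 (i)(ii) with `hest` read at `decompositionDataOfChart (ofPresentation …) ι` and the
conclusion at an arbitrary `Rc′`, with no `Rc`/`hRcV`/`hRcB` binder left.  Nothing is asserted here;
typed ≠ proved; no side taken on [IUTchIII] Cor. 3.12.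
-/

namespace Literature.AnabelianGeometry.SemiGraphs

namespace ProfiniteSemiGraph

universe u

variable {𝒢 : ProfiniteSemiGraph.{u}} (c : TemperedPiChart 𝒢) (P : SemiGraph.SubgroupPresentation 𝒢.graph c.G)
  (hPH : ∀ w, P.H w ∈ verticialSubgroups c w) (hPM : ∀ e, P.M e ∈ edgeLikeSubgroups c e)

/-- **The compatible §3 representatives read off a subgroup presentation** `P = (H_w, M_e, s_b)` of
`π₁^temp(𝒢)` whose vertex / edge groups are verticial / edge-like (`hPH`, `hPM`): the verticial
representative at `v` is `H_v`, the edge-like representative attached to the branch `b` is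
`s_b · M_{e(b)} · s_b⁻¹ ⊆ H_v` (the presentation axiom).  This is the choice at which the decomposition data of
[SemiAnbd] p. 65 are the decomposition groups of the reference vertex and branch lifts of the coset trees.
[cite: MochizukiSemiAnbd2006, §5, p. 65] -/
def ChartRepresentatives.ofPresentation : ChartRepresentatives c where
  Hv := P.H
  Hv_mem := hPH
  Hb b := (P.M (𝒢.graph.edgeOf b)).map (MulAut.conj (P.s b)).toMonoidHom
  Hb_mem b := conj_mem_edgeLikeSubgroups' c (hPM _) _
  Hb_le b v hbv := by
    rintro _ ⟨m, hm, rfl⟩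
    exact P.conj_mem b v hbv m hm

/-- The verticial representatives read off `P` are its vertex groups (`hRcV` as a `rfl` lemma).
[cite: MochizukiSemiAnbd2006, §5, p. 65] -/
@[simp] theorem ChartRepresentatives.ofPresentation_Hv (v : 𝒢.graph.Vertex) :
    (ChartRepresentatives.ofPresentation c P hPH hPM).Hv v = P.H v := rfl

/-- The edge-like representatives read off `P` are the conjugates `s_b M_{e(b)} s_b⁻¹` (`hRcB` as a `rfl` lemma).
[cite: MochizukiSemiAnbd2006, §5, p. 65] -/
@[simp] theorem ChartRepresentatives.ofPresentation_Hb (b : 𝒢.graph.Branch) :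
    (ChartRepresentatives.ofPresentation c P hPH hPM).Hb b =
      (P.M (𝒢.graph.edgeOf b)).map (MulAut.conj (P.s b)).toMonoidHom := rfl

/-- The two matching equations of the Thm 5.4 theorem of record (`hRcV`, `hRcB`) hold for the representatives
read off `P`, packaged as one statement. [cite: MochizukiSemiAnbd2006, §5, p. 65] -/
theorem ChartRepresentatives.ofPresentation_spec :
    (∀ v, (ChartRepresentatives.ofPresentation c P hPH hPM).Hv v = P.H v) ∧
      ∀ b, (ChartRepresentatives.ofPresentation c P hPH hPM).Hb b =
        (P.M (𝒢.graph.edgeOf b)).map (MulAut.conj (P.s b)).toMonoidHom :=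
  ⟨fun _ => rfl, fun _ => rfl⟩

end ProfiniteSemiGraph

end Literature.AnabelianGeometry.SemiGraphs
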